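import Mathlib
import HarnessLib
import Summits.NavierStokesRegularity.NavierStokesRegularity.Theorems.PoloidalWindowDoorLrcModEntireTwistingTHVerticalLine
import Summits.NavierStokesRegularity.NavierStokesRegularity.Theorems.PoloidalWindowDoorLrcModEntireTwistingTHSlopeFunction
import Summits.NavierStokesRegularity.NavierStokesRegularity.Theorems.PoloidalWindowDoorLrcModEntireTwistingTHRidgeLaw
import Summits.NavierStokesRegularity.NavierStokesRegularity.Theorems.PoloidalWindowDoorLrcModEntireTwistingTHFlatSlab

/-!
# Item `LrcModEntire` (stmt-NavierStokesRegularity-20428), registry twist_split v7 — THE HYPERBOLIC LAYER THEOREM of the (TH) column (memo `Cruxes/LrcModEntire/T2B-g14.md` §14d):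
# at a transversally non-degenerate hot point the slope `μ(−1, z)` is `< 0` on a punctured neighbourhood of the thread plane, unless the vertical shear vanishes on a whole slab

LEAD of item 20428 ns-poloidal-K2-p3 g14 (`--supports stmt-NavierStokesRegularity-20428 --as helper`).  Class profile (slice `v(−1,·)` smooth, `Clebsch.contDiff_slice`), divergence
free, the GLOBAL bilinear (TH) clause `hTH` of the `stub_T2b` binder, the hot-spot normalisation `√(−t)|v₂| ≤ |N|`, a hot point `y ∈ P₀` (`v₂(−1,y) = N`, `∂₂v₂(−1,y) = 0`) at which
`σΔₕv₂(−1,y) < 0` (`σN > 0`), and a non-flatness witness `∂_{c₁}v₂(−1,y₁) ≠ 0`, `y₁ ∈ P₀`, `c₁ ≠ 2` (properness, `…NonflatPlane`).  With the slope RATIO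
`μ(z) := ∂₂v_{c₁}(−1, y₁ + z e₂) / ∂_{c₁}v₂(−1, y₁ + z e₂)` (analytic in `z`, `…SlopeFunction.analyticAt_entry_family`; by `hTH` it is THE slope of the plane `P_z`:
`∂₂v_b = μ(z)∂_bv₂` on `P_z`, `b ≠ 2`), the plane-wave identity `∂₂²v₂ = −μ(z)Δₕv₂` on `P_z` (`…TimeHeightShearLinearSlice.plane_wave_identity`) turns the vertical line through `y` into
an instance of `…TwistingTHVerticalLine.slope_dichotomy_of_verticalLine`:

* `slope_dichotomy_of_hotPoint` — **either the vertical shear vanishes on a slab, `∂₂v_b(−1,x) = 0` for all `x` with `|x₂|` small and `b ≠ 2` (then the slice is z-flat near `P₀`;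
  dead modulo time-analyticity, memo §14d), or `μ(z) < 0` for all small `z ≠ 0`**: the thread plane of a surviving `stub_T2b` ridge lies in a HYPERBOLIC-or-degenerate layer
  (`μ ≤ 0`), never next to an elliptic one.  Together with `…TwistingTHSlopeSign.slopeFunction_nonpos` (`μ(0) ≤ 0`) this is the survivor portrait of memo §14.

WHAT THIS IS NOT: not a claim about Navier–Stokes regularity and not a proof of `stub_T2b` — structure of its hypothetical ridge (bears_on LADDER-NS N0, item 20428 / crux 19708; both
OPEN, ⟨27893⟩ OPEN).
-/

set_option linter.style.longLine false
set_option linter.dupNamespace false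

namespace Summit.NavierStokesRegularity.NavierStokesRegularity.Theorems.PoloidalWindowDoorLrcModEntireTwistingTHHyperbolicLayer

open Set Function Filter Topology Metric
open scoped RealInnerProductSpace InnerProductSpace ContDiff
open Literature.Analysis Literature.Analysis.FluidPDE Literature.Analysis.UnboundedOperators
open Summit.NavierStokesRegularity.NavierStokesRegularity.Theorems
open Summit.NavierStokesRegularity.NavierStokesRegularity.Theorems.PoloidalWindowDoorLrcModEntireTwistingTHVerticalLine
open Summit.NavierStokesRegularity.NavierStokesRegularity.Theorems.PoloidalWindowDoorLrcModEntireTwistingTHSlopeFunction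
open Summit.NavierStokesRegularity.NavierStokesRegularity.Theorems.PoloidalWindowDoorPoloidalWindowRigidityTimeHeightShearLinearSlice
open Summit.NavierStokesRegularity.NavierStokesRegularity.Theorems.PoloidalWindowDoorPoloidalWindowRigidityConstantShearSlice
open Summit.NavierStokesRegularity.NavierStokesRegularity.Theorems.PoloidalWindowDoorPoloidalWindowRigidityClebsch
open Summit.NavierStokesRegularity.NavierStokesRegularity.Theorems.PoloidalWindowDoorLrcModEntireTwistingTHFlatSlab (hasDerivAt_vertical)

variable {C : ℝ} {v : ℝ → EuclideanSpace ℝ (Fin 3) → EuclideanSpace ℝ (Fin 3)}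

/-- **THE HYPERBOLIC LAYER THEOREM.**  See the module docstring. -/
theorem slope_dichotomy_of_hotPoint (hdec : HasTypeITimeDecay C v) (hcont : ContinuousOn (uncurry v) (Iio (0 : ℝ) ×ˢ univ))
    (hmild : ∀ s t : ℝ, s < t → t < 0 → ∀ x, v t x = heatExtension (v s) (t - s) x - oseenDuhamel 1 s v v t x)
    (hdiv : ∀ t < 0, VectorCalculus.IsDivFree (v t))
    (hTH : ∀ t < 0, ∀ x x' : EuclideanSpace ℝ (Fin 3), x 2 = x' 2 → ∀ b c : Fin 3, b ≠ 2 → c ≠ 2 →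
      fderiv ℝ (v t) x (EuclideanSpace.single 2 1) b * fderiv ℝ (v t) x' (EuclideanSpace.single c 1) 2 =
        fderiv ℝ (v t) x' (EuclideanSpace.single 2 1) c * fderiv ℝ (v t) x (EuclideanSpace.single b 1) 2)
    (hhot : ∀ t < 0, ∀ x, Real.sqrt (-t) * |v t x 2| ≤ |v (-1) 0 2|)
    {σ : ℝ} (hσ : σ = 1 ∨ σ = -1) (hσN : 0 < σ * v (-1) 0 2)
    {y : EuclideanSpace ℝ (Fin 3)} (hy2 : y 2 = 0) (hyhot : v (-1) y 2 = v (-1) 0 2)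
    (hycrit : fderiv ℝ (fun x => v (-1) x 2) y (EuclideanSpace.single 2 1) = 0)
    (hΔ : σ * (fderiv ℝ (fun x => fderiv ℝ (fun x' => v (-1) x' 2) x (EuclideanSpace.single 0 (1 : ℝ))) y (EuclideanSpace.single 0 (1 : ℝ)) +
        fderiv ℝ (fun x => fderiv ℝ (fun x' => v (-1) x' 2) x (EuclideanSpace.single 1 (1 : ℝ))) y (EuclideanSpace.single 1 (1 : ℝ))) < 0)
    {y₁ : EuclideanSpace ℝ (Fin 3)} (hy₁ : y₁ 2 = 0) {c₁ : Fin 3} (hc₁ : c₁ ≠ 2)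
    (hne₁ : fderiv ℝ (v (-1)) y₁ (EuclideanSpace.single c₁ 1) 2 ≠ 0) :
    (∀ᶠ z in 𝓝 (0 : ℝ), ∀ x : EuclideanSpace ℝ (Fin 3), x 2 = z → ∀ b : Fin 3, b ≠ 2 → fderiv ℝ (v (-1)) x (EuclideanSpace.single 2 1) b = 0) ∨
    (∀ᶠ z in 𝓝[≠] (0 : ℝ),
      fderiv ℝ (v (-1)) (y₁ + z • EuclideanSpace.single 2 (1 : ℝ)) (EuclideanSpace.single 2 1) c₁ /
        fderiv ℝ (v (-1)) (y₁ + z • EuclideanSpace.single 2 (1 : ℝ)) (EuclideanSpace.single c₁ 1) 2 < 0) := by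
  have hs : (-1 : ℝ) < 0 := by norm_num
  -- names
  set e₂ : EuclideanSpace ℝ (Fin 3) := EuclideanSpace.single 2 (1 : ℝ) with he₂
  set num : ℝ → ℝ := fun z => fderiv ℝ (v (-1)) (y₁ + z • e₂) e₂ c₁ with hnum
  set den : ℝ → ℝ := fun z => fderiv ℝ (v (-1)) (y₁ + z • e₂) (EuclideanSpace.single c₁ 1) 2 with hden
  set μ : ℝ → ℝ := fun z => num z / den z with hμ
  set G : EuclideanSpace ℝ (Fin 3) → ℝ := fun x => v (-1) x 2 with hG
  set G₂ : EuclideanSpace ℝ (Fin 3) → ℝ := fun x => fderiv ℝ G x e₂ with hG₂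
  set S : EuclideanSpace ℝ (Fin 3) → ℝ := fun x =>
    fderiv ℝ (fun x => fderiv ℝ G x (EuclideanSpace.single 0 (1 : ℝ))) x (EuclideanSpace.single 0 (1 : ℝ)) +
      fderiv ℝ (fun x => fderiv ℝ G x (EuclideanSpace.single 1 (1 : ℝ))) x (EuclideanSpace.single 1 (1 : ℝ)) with hS
  -- smoothness of the slice
  have hu : ContDiff ℝ ∞ (v (-1)) := contDiff_slice hdec hcont hmild hs
  have hu2 : ContDiff ℝ 2 (v (-1)) := hu.of_le (by norm_cast)
  have hG3 : ContDiff ℝ 3 G := by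
    have h3 : ContDiff ℝ 3 (v (-1)) := hu.of_le (by norm_cast)
    exact (EuclideanSpace.proj (2 : Fin 3)).contDiff.comp h3
  have hGd : Differentiable ℝ G := hG3.differentiable (by norm_num)
  have hfd : ∀ w : EuclideanSpace ℝ (Fin 3), ContDiff ℝ 2 (fun x => fderiv ℝ G x w) := fun w =>
    (hG3.fderiv_right (m := 2) (by norm_cast)).clm_apply contDiff_const
  have hG₂d : Differentiable ℝ G₂ := (hfd e₂).differentiable (by norm_num)
  have hsd : ∀ w w' : EuclideanSpace ℝ (Fin 3), Continuous (fun x => fderiv ℝ (fun x => fderiv ℝ G x w) x w') := fun w w' =>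
    (((hfd w).fderiv_right (m := 1) (by norm_cast)).clm_apply contDiff_const).continuous
  -- analyticity of the ratio entries and a neighbourhood where the denominator is non-zero
  have hline : AnalyticAt ℝ (fun z : ℝ => (((-1 : ℝ), z) : ℝ × ℝ)) 0 := analyticAt_const.prod analyticAt_id
  have hnumA : AnalyticAt ℝ num 0 := by
    have h := analyticAt_entry_family hdec hcont hmild y₁ 2 c₁ (p := ((-1 : ℝ), (0 : ℝ))) hs
    exact h.comp_of_eq hline rfl
  have hdenA : AnalyticAt ℝ den 0 := by
    have h := analyticAt_entry_family hdec hcont hmild y₁ c₁ 2 (p := ((-1 : ℝ), (0 : ℝ))) hs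
    exact h.comp_of_eq hline rfl
  have hden0 : den 0 ≠ 0 := by simpa [hden] using hne₁
  have hμA : AnalyticAt ℝ μ 0 := hnumA.div hdenA hden0
  obtain ⟨δ, hδ, hdenB⟩ := Metric.eventually_nhds_iff.1 (hdenA.continuousAt.eventually_ne hden0)
  have hdenz : ∀ z : ℝ, |z| < δ → den z ≠ 0 := fun z hz => hdenB (by rwa [dist_zero_right, Real.norm_eq_abs])
  -- (TH) with the slope `μ z` on the whole plane `P_z`, `|z| < δ`
  have hslope : ∀ z : ℝ, |z| < δ → ∀ x : EuclideanSpace ℝ (Fin 3), x 2 = z → ∀ b : Fin 3, b ≠ 2 →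
      fderiv ℝ (v (-1)) x (EuclideanSpace.single 2 (1 : ℝ)) b = μ z * fderiv ℝ (v (-1)) x (EuclideanSpace.single b (1 : ℝ)) 2 := by
    intro z hz x hx b hb
    have hx' : x 2 = (y₁ + z • e₂) 2 := by simp [he₂, hy₁, hx]
    have h := hTH (-1) hs x (y₁ + z • e₂) hx' b c₁ hb hc₁
    have hd := hdenz z hz
    simp only [hμ, hnum, hden, he₂] at hd ⊢
    field_simp
    linarith [h]
  -- the vertical line data
  set a : ℝ → ℝ := fun z => σ * G (y + z • e₂) with ha
  set a' : ℝ → ℝ := fun z => σ * G₂ (y + z • e₂) with ha'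
  set b : ℝ → ℝ := fun z => σ * S (y + z • e₂) with hb
  have hA : ∀ z ∈ Ioo (-δ) δ, HasDerivAt a (a' z) z := fun z _ => by
    simpa [ha, ha', hG₂] using (hasDerivAt_vertical hGd y z).const_mul σ
  have hA' : ∀ z ∈ Ioo (-δ) δ, HasDerivAt a' (-(μ z * b z)) z := by
    intro z hz
    have hz' : |z| < δ := abs_lt.2 hz
    have h1 : HasDerivAt (fun z : ℝ => G₂ (y + z • e₂)) (fderiv ℝ G₂ (y + z • e₂) e₂) z := hasDerivAt_vertical hG₂d y z
    -- plane-wave identity at `y + z e₂ ∈ P_z`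
    have hx2 : (y + z • e₂) 2 = z := by simp [he₂, hy2]
    have hpw := plane_wave_identity (u := v (-1)) (μ := μ z) (c := z) hu2 (fun x => div_coord (hdiv (-1) hs) x)
      (fun x hx bb hbb => hslope z hz' x hx bb hbb) hx2
    have h2 : fderiv ℝ G₂ (y + z • e₂) e₂ = -μ z * S (y + z • e₂) := by
      simpa [hG₂, hG, hS, he₂] using hpw
    have h3 := h1.const_mul σ
    rw [h2] at h3
    have e : σ * (-μ z * S (y + z • e₂)) = -(μ z * b z) := by simp only [hb]; ring
    rw [e] at h3
    simpa [ha'] using h3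
  -- `a ≤ a 0` (hot-spot normalisation at `t = -1`), `a' 0 = 0`, `b 0 < 0`, `b` continuous
  have hmax : ∀ z ∈ Ioo (-δ) δ, a z ≤ a 0 := by
    intro z _
    have h1 := hhot (-1) hs (y + z • e₂)
    rw [neg_neg, Real.sqrt_one, one_mul] at h1
    have hN : |v (-1) 0 2| = σ * v (-1) 0 2 := by
      rcases hσ with h | h
      · rw [h, one_mul] at hσN ⊢; exact abs_of_pos hσN
      · rw [h, neg_one_mul] at hσN ⊢; exact abs_of_neg (by linarith)
    have hσθ : σ * v (-1) (y + z • e₂) 2 ≤ |v (-1) (y + z • e₂) 2| := by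
      rcases hσ with h | h
      · rw [h, one_mul]; exact le_abs_self _
      · rw [h, neg_one_mul]; exact neg_le_abs _
    simp only [ha, hG, zero_smul, add_zero, hyhot]
    linarith
  have hA'0 : a' 0 = 0 := by
    show σ * G₂ (y + (0 : ℝ) • e₂) = 0
    rw [zero_smul, add_zero]
    have h0 : G₂ y = 0 := by simpa [hG₂, hG, he₂] using hycrit
    rw [h0, mul_zero]
  have hbcont : ContinuousAt b 0 := by
    have hSc : Continuous S := (hsd _ _).add (hsd _ _)
    exact (continuous_const.mul (hSc.comp (by fun_prop : Continuous fun z : ℝ => y + z • e₂))).continuousAt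
  have hb0 : b 0 < 0 := by simpa [hb, hS, hG, zero_smul, add_zero] using hΔ
  -- the vertical line lemma
  rcases slope_dichotomy_of_verticalLine hδ hA hA' hmax hA'0 hbcont hb0 hμA with hflat | hneg
  · left
    have hball : ∀ᶠ z in 𝓝 (0 : ℝ), |z| < δ := by
      filter_upwards [Metric.ball_mem_nhds (0 : ℝ) hδ] with z hz
      rwa [Metric.mem_ball, dist_zero_right, Real.norm_eq_abs] at hz
    filter_upwards [hflat, hball] with z hz hzδ x hx bb hbb
    rw [hslope z hzδ x hx bb hbb, hz, zero_mul]
  · right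
    simpa [hμ, hnum, hden, he₂] using hneg

end Summit.NavierStokesRegularity.NavierStokesRegularity.Theorems.PoloidalWindowDoorLrcModEntireTwistingTHHyperbolicLayer
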